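import Summits.HodgeConjecture.CorCM.MultiFieldWeilAnyTwoSimpleThreefoldsAnyCurve
import Summits.HodgeConjecture.CorCM.DistinctPrimeDimensionsCMHodge
import HarnessLib

/-!
# MULTI-FIELD WEIL ENGINE — ANY TWO SIMPLE CM ABELIAN VARIETIES OF DIMENSION `≤ 3` AND ANY CM ELLIPTIC CURVE: the Hodge conjecture for every
# `A₀^a × A₁^b × E′^c`, given ONLY Markman's fourfold theorem

Cell `pub-hodgecm2` (COR-CM), seat b30 gen 34 (2026-08-24); count-neutral own lane MULTI-FIELD WEIL ENGINE (stem `MultiFieldWeil*`), sequel of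
`CorCM/MultiFieldWeilAnyTwoSimpleThreefoldsAnyCurve.lean` (two simple threefolds and a curve) and of gen 33's `CorCM/MultiFieldWeilAnyTwoSimpleDimLeThreeForeignCurve.lean`
(two simple varieties of dimension `≤ 3` and a FOREIGN curve).  Theorems only; no definition, no named fact, no `sorry`.  HONEST FRAMING: conditional on the displayed
Markman fourfold binder only; `HC_CM` is NOT proved and not asserted.

THE STATEMENT (**`hodgeConjectureFor_biproduct_comp_vec_of_any_two_simple_dim_le_three_cmCurve_of_markman`**).  `A₀ ⊨ (K₀; Φ₀)`, `A₁ ⊨ (K₁; Φ₁)` ANY two SIMPLE complex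
abelian varieties of CM type of dimension `≤ 3`, `E′ ⊨ (k′; Ψ′)` ANY CM elliptic curve — nothing else.  Then for every `κ : Fin N → Fin 3` — every `A₀^a × A₁^b × E′^c` —
the Hodge conjecture holds for `⨁_j ![A₀, A₁, E′] (κ j)`, GIVEN ONLY `Markman2025_weilClasses_algebraic_abelianFourfold`; with the dominated ∕ isogenous forms.  So: for
ANY THREE simple CM abelian varieties of dimension `≤ 3` at least one of which is a curve, every product of copies satisfies the Hodge conjecture modulo Markman's
theorem on the Weil classes of abelian fourfolds.

PROOF.  Where does `k′` go?  Into NEITHER field: gen 33's S6.  Into a QUADRATIC `K_i`: then `k′ ≅ K_i` and `E′ ∼ A_i` (b16's `isIsogenous_of_ringEquiv`), so the product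
is isogenous to a product of copies of `A₀, A₁` (gen 31's G7).  Into a QUARTIC `K_i`: impossible — a quartic CM field with a primitive type receives no imaginary
quadratic field (b16's `QuarticCM.exists_ringAut_smul_smul_eq_conjugate_of_isPrimitive` with `isEmpty_ringHom_of_smul_smul_of_isTotallyComplex`).  Into a SEXTIC `K_i`
(and not into the other field, or the other field is sextic too): §1 ∕ the previous file — the curve is ABSORBED by the threefold `A_i`
(`cmFamilyRank_comp_eq_of_quadratic_slot_of_odd`), the pair `(A_i, A_{1−i})` is nondegenerate by b16's censuses (`isNondegenerateFamily_iff_primeDim_simple_dim_le_three`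
for a partner of dimension `≤ 2`, `isNondegenerateFamily_simpleThreefolds_iff` for a threefold partner: no imaginary quadratic subfield of `K_i` embeds in `K_{1−i}`, the
only one being `k′`), so the blocks `{A_i, E′} ∣ {A_{1−i}}` are additive and b16's gluing assembles gen 31's G6 (`E′ × A_i`, mod Markman) with the powers of `A_{1−i}`.

[cite: MoonenZarhin1999LowDim, Thm. (0.1), Thm. (0.2), §3 (3.1), §5 (5.2)] [cite: Markman2025SurveySecant, Thm. 1.2] [cite: Gordon1999HodgeAVSurvey, §3 Theorem (proof), 7.4–7.7]
[cite: Shimura1998, §6.1 Corollary of Theorem 2 (p. 41), §8.4 (2), §18.1] [cite: MumfordAV1970, §19 Thm. 1 and p. 169]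

## References
* [MoonenZarhin1999LowDim] B. Moonen, Yu. Zarhin, Math. Ann. 315 (1999) 711–733.  [Markman2025SurveySecant] E. Markman, arXiv:2509.23403, Thm. 1.2.
  [Gordon1999HodgeAVSurvey] B. B. Gordon, *A survey of the Hodge conjecture for abelian varieties*, §3, 7.4–7.7.  [Shimura1998] G. Shimura, *Abelian varieties with
  complex multiplication and modular functions*, §6.1, §8.4, §18.1.  [MumfordAV1970] D. Mumford, *Abelian Varieties*, §19.
-/

noncomputable section

open CategoryTheory CategoryTheory.Limits NumberField IntermediateField

namespace Summit.HodgeConjecture.CorCM.MultiFieldWeil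

open Literature.AlgebraicGeometry Literature.AlgebraicGeometry.Motives Literature.AlgebraicGeometry.HodgeTheory
open Literature.AlgebraicGeometry.ComplexMultiplication (IsCMTypeRealisation isSimple_iff_isPrimitive)
open Literature.AlgebraicTopology.SingularHomology
open Literature.NumberTheory.ComplexMultiplication
open Literature.AlgebraicGeometry.Pohlmann1968 (IsNondegenerate)
open Literature.AlgebraicGeometry.Pohlmann1968.CMAlgebra

open scoped Classical

section DimLeThreeCurve

variable {K₀ K₁ k' : Type} [Field K₀] [NumberField K₀] [IsCMField K₀] [Field K₁] [NumberField K₁] [IsCMField K₁] [Field k'] [NumberField k'] [IsCMField k']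
  {N : ℕ} {A₀ A₁ E' : AbelianVariety ℂ} {Φ₀ : CMType K₀} {Φ₁ : CMType K₁} {Ψ' : CMType k'}
  {ι₀ : 𝓞 K₀ →+* End A₀} {θ₀ : K₀ →+* Module.End ℂ (complexBetti A₀.X 1)}
  {ι₁ : 𝓞 K₁ →+* End A₁} {θ₁ : K₁ →+* Module.End ℂ (complexBetti A₁.X 1)}
  {ιE' : 𝓞 k' →+* End E'} {θE' : k' →+* Module.End ℂ (complexBetti E'.X 1)}

/-! ## §1 A simple CM threefold absorbing the curve, against ANY simple partner of dimension `≤ 3` avoiding `k′` -/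

/-- **THE ABSORBED-CURVE GLUING, general partner.**  `A₀ ⊨ (K₀; Φ₀)` a SIMPLE CM threefold (`[K₀ : ℚ] = 6`) with `i₀ : k′ ↪ K₀`, `E′ ⊨ (k′; Ψ′)` a CM elliptic curve,
`A₁ ⊨ (K₁; Φ₁)` ANY simple CM abelian variety of dimension `≤ 3` with `k′ ↪̸ K₁`.  Then for every `κ : Fin N → Fin 3` the Hodge conjecture holds for
`⨁_j ![A₀, A₁, E′] (κ j)`, GIVEN ONLY Markman's fourfold theorem.  `A₀ ∼ A₁`: a product of copies of `A₀, E′` up to isogeny (gen 31's G6).  `A₀ ≁ A₁`: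
`rank(A₀ A₁ E′) = rank(A₀ A₁)` and `rank(A₀ E′) = rank(A₀)` (CURVE ABSORPTION, `[K₀ : ℚ]/2 = 3` odd), `rank(A₀ A₁) = rank A₀ + rank A₁ − 1` (b16's censuses: no imaginary
quadratic subfield of `K₀` embeds in `K₁`, the only one being `≅ k′`) ⟹ the blocks `{A₀, E′} ∣ {A₁}` are additive, and b16's block gluing assembles G6 with the powers of
`A₁`. [cite: MoonenZarhin1999LowDim, Thm. (0.1) (a), Thm. (0.2), §3 (3.1), §5 (5.2)] [cite: Markman2025SurveySecant, Thm. 1.2] [cite: Gordon1999HodgeAVSurvey, §3 Theorem (proof), 7.5–7.7] -/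
theorem hodgeConjectureFor_biproduct_comp_vec_of_simpleThreefold_absorbedCurve_simple_dim_le_three_of_markman
    (hW4 : Markman2025_weilClasses_algebraic_abelianFourfold) (h6₀ : Module.finrank ℚ K₀ = 6) (h2' : Module.finrank ℚ k' = 2)
    (hA₀ : IsCMTypeRealisation Φ₀ A₀ ι₀ θ₀) (hA₁ : IsCMTypeRealisation Φ₁ A₁ ι₁ θ₁) (hE' : IsCMTypeRealisation Ψ' E' ιE' θE') (hS₀ : A₀.IsSimple) (hS₁ : A₁.IsSimple)
    (h3₁ : A₁.dim ≤ 3) (i₀ : k' →+* K₀) (h₁ : IsEmpty (k' →+* K₁)) (κ : Fin N → Fin 3) :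
    HodgeConjectureFor (⨁ fun j => (![A₀, A₁, E'] : Fin 3 → AbelianVariety ℂ) (κ j)).dim (⨁ fun j => (![A₀, A₁, E'] : Fin 3 → AbelianVariety ℂ) (κ j)).X := by
  -- `A₀ ∼ A₁`: a product of copies of `E', A₀` up to isogeny
  by_cases hiso : AbelianVariety.IsIsogenous A₀ A₁
  · refine hodgeConjectureFor_of_isIsogenous_biproduct_comp_of_cmCurve_simpleThreefold_of_markman hW4 h2' h6₀ hE' hA₀ hS₀
      (fun j => (![1, 1, 0] : Fin 3 → Fin 2) (κ j)) (AbelianVariety.IsIsogenous.biproduct fun j => ?_)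
    show AbelianVariety.IsIsogenous ((![A₀, A₁, E'] : Fin 3 → AbelianVariety ℂ) (κ j))
      ((![E', A₀] : Fin 2 → AbelianVariety ℂ) ((![1, 1, 0] : Fin 3 → Fin 2) (κ j)))
    generalize κ j = c
    fin_cases c
    · exact AbelianVariety.IsIsogenous.refl A₀
    · exact hiso.symm'
    · exact AbelianVariety.IsIsogenous.refl E'
  have hd₀ : A₀.dim = 3 := by
    have h := Literature.AlgebraicGeometry.Pohlmann1968.finrank_eq_two_mul_dim_of_isCMTypeRealisation hA₀
    omega
  have h3₀ : A₀.dim ≤ 3 := hd₀.le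
  -- the family of fields `(K₀, K₁, k')` with its instances (all identifications below are definitional)
  let Kf : Fin 3 → Type := Fin.cons K₀ (Fin.cons K₁ (Fin.cons k' finZeroElim))
  letI instF : ∀ j, Field (Kf j) := Fin.cons ‹Field K₀› (Fin.cons ‹Field K₁› (Fin.cons ‹Field k'› finZeroElim))
  letI instN : ∀ j, NumberField (Kf j) := Fin.cons ‹NumberField K₀› (Fin.cons ‹NumberField K₁› (Fin.cons ‹NumberField k'› finZeroElim))
  haveI instC : ∀ j, IsCMField (Kf j) := Fin.cons ‹IsCMField K₀› (Fin.cons ‹IsCMField K₁› (Fin.cons ‹IsCMField k'› finZeroElim))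
  let Φf : ∀ j : Fin 3, CMType (Kf j) := Fin.cons Φ₀ (Fin.cons Φ₁ (Fin.cons Ψ' finZeroElim))
  let ιf : ∀ j : Fin 3, 𝓞 (Kf j) →+* End ((![A₀, A₁, E'] : Fin 3 → AbelianVariety ℂ) j) := Fin.cons ι₀ (Fin.cons ι₁ (Fin.cons ιE' finZeroElim))
  let θf : ∀ j : Fin 3, Kf j →+* Module.End ℂ (complexBetti ((![A₀, A₁, E'] : Fin 3 → AbelianVariety ℂ) j).X 1) :=
    Fin.cons θ₀ (Fin.cons θ₁ (Fin.cons θE' finZeroElim))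
  have hA : ∀ j, IsCMTypeRealisation (Φf j) ((![A₀, A₁, E'] : Fin 3 → AbelianVariety ℂ) j) (ιf j) (θf j) :=
    Fin.cons hA₀ (Fin.cons hA₁ (Fin.cons hE' finZeroElim))
  have hnd₀ : IsNondegenerate (Φf 0) := isNondegenerate_of_isSimple_of_dim_le_three_slot hA (b := 0) hS₀ h3₀
  have hnd₁ : IsNondegenerate (Φf 1) := isNondegenerate_of_isSimple_of_dim_le_three_slot hA (b := 1) hS₁ h3₁
  have h2f : Module.finrank ℚ (Kf 2) = 2 := h2'
  have hodd : ¬ 2 ∣ Module.finrank ℚ (Kf 0) / 2 := by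
    rw [show Module.finrank ℚ (Kf 0) = 6 from h6₀]
    decide
  have hK₁ : Module.finrank ℚ K₁ = 2 * A₁.dim := Literature.AlgebraicGeometry.Pohlmann1968.finrank_eq_two_mul_dim_of_isCMTypeRealisation hA₁
  -- (a) the pair `(A₀, A₁)` is nondegenerate: rank `4 + [K₁:ℚ]/2`
  have hI : ∀ j : Fin 2, j = 0 ∨ j = 1 := fun j => by fin_cases j <;> simp
  have hSf : ∀ j : Fin 2, ((![A₀, A₁, E'] : Fin 3 → AbelianVariety ℂ) (Fin.castSucc j)).IsSimple := by
    intro j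
    fin_cases j
    · exact hS₀
    · exact hS₁
  have hno := not_exists_quadratic_ringHom_of_isEmpty (K₁ := K₁) h2' h6₀ i₀ h₁
  have hpairND : IsNondegenerateFamily (fun j : Fin 2 => Φf (Fin.castSucc j)) := by
    by_cases hd₁ : A₁.dim = 3
    · -- a threefold partner: b16's census of pairs of simple threefolds
      refine (isNondegenerateFamily_simpleThreefolds_iff (Φ := fun j : Fin 2 => Φf (Fin.castSucc j))
        (A := fun j => (![A₀, A₁, E'] : Fin 3 → AbelianVariety ℂ) (Fin.castSucc j)) (ι := fun j => ιf (Fin.castSucc j))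
        (θ := fun j => θf (Fin.castSucc j)) (i₀ := (0 : Fin 2)) (i₁ := 1) zero_ne_one hI ?_ (fun j => hA (Fin.castSucc j)) hSf ?_).2 hno
      · intro j
        fin_cases j
        · exact h6₀
        · show Module.finrank ℚ K₁ = 6
          omega
      · intro i j hij
        fin_cases i <;> fin_cases j
        · exact absurd rfl hij
        · exact hiso
        · exact fun h => hiso h.symm'
        · exact absurd rfl hij
    · -- a partner of dimension `≤ 2`: b16's prime-dimension census (`p = 3`)
      exact (isNondegenerateFamily_iff_primeDim_simple_dim_le_three (Φ := fun j : Fin 2 => Φf (Fin.castSucc j))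
        (A := fun j => (![A₀, A₁, E'] : Fin 3 → AbelianVariety ℂ) (Fin.castSucc j)) (ι := fun j => ιf (Fin.castSucc j))
        (θ := fun j => θf (Fin.castSucc j)) (i₀ := (0 : Fin 2)) (i₁ := 1) zero_ne_one hI Nat.prime_three (by decide)
        (fun j => hA (Fin.castSucc j)) hd₀ h3₁ (by show A₁.dim < 3; omega) hSf).2 hno
  have hpair : cmFamilyRank (fun j : Fin 2 => Φf (Fin.castSucc j)) = (6 + Module.finrank ℚ K₁) / 2 + 1 := by
    have h := hpairND
    rw [isNondegenerateFamily_iff, Fin.sum_univ_two, show Module.finrank ℚ (Kf (Fin.castSucc 0)) = 6 from h6₀] at h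
    exact h
  -- (b) the curve is absorbed by `A₀`
  have hrank : cmFamilyRank Φf = (6 + Module.finrank ℚ K₁) / 2 + 1 := by
    rw [← hpair]
    refine (cmFamilyRank_comp_eq_of_quadratic_slot_of_odd Φf (i₀ := 2) h2f Fin.castSucc (fun i hi => ?_) 0 i₀ hodd).symm
    fin_cases i
    · exact ⟨0, rfl⟩
    · exact ⟨1, rfl⟩
    · exact absurd rfl hi
  -- the blocks `{A₁}` (true) and `{A₀, E'}` (false)
  let κb : Fin 3 → Bool := fun i => decide (i = 1)
  -- (c) the block `{A₀, E'}`: the curve is absorbed by `A₀`, rank `4`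
  have hX : cmFamilyRank (fun i : {i : Fin 3 // κb i = false} => Φf i.1) = 4 := by
    have h := cmFamilyRank_comp_eq_of_quadratic_slot_of_odd (fun i : {i : Fin 3 // κb i = false} => Φf i.1) (i₀ := ⟨2, by decide⟩) h2f
      (fun _ : Fin 1 => (⟨0, by decide⟩ : {i : Fin 3 // κb i = false})) (fun i hi => ?_) 0 i₀ hodd
    · rw [← h]
      have h1 := cmFamilyRank_eq_of_isNondegenerate_of_unique (K := fun _ : Fin 1 => K₀) (fun _ : Fin 1 => Φ₀) hnd₀
      rw [h6₀] at h1
      exact h1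
    · obtain ⟨i, hi'⟩ := i
      fin_cases i
      · exact ⟨0, rfl⟩
      · exact absurd hi' (by decide)
      · exact absurd rfl hi
  -- (d) the block `{A₁}`: rank `[K₁:ℚ]/2 + 1`
  have hY : cmFamilyRank (fun i : {i : Fin 3 // κb i = true} => Φf i.1) = Module.finrank ℚ K₁ / 2 + 1 := by
    letI : Unique {i : Fin 3 // κb i = true} := ⟨⟨⟨1, by decide⟩⟩, fun i => Subtype.ext (of_decide_eq_true i.2)⟩
    exact cmFamilyRank_eq_of_isNondegenerate_of_unique (fun i : {i : Fin 3 // κb i = true} => Φf i.1) hnd₁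
  -- (e) the rank equation over the two blocks
  have hadd : cmFamilyRank Φf + Fintype.card Bool = (∑ c : Bool, cmFamilyRank fun i : {i : Fin 3 // κb i = c} => Φf i.1) + 1 := by
    rw [Fintype.card_bool, Fintype.sum_bool, hX, hY, hrank, hK₁]
    omega
  -- (f) glue
  cases N with
  | zero =>
    have hfun : (fun j => (![A₀, A₁, E'] : Fin 3 → AbelianVariety ℂ) (κ j)) = fun _ : Fin 0 => A₀ := funext fun j => j.elim0
    rw [hfun]
    exact hodgeConjectureFor_biproduct_const_of_dim_le_three hA₀ h3₀ 0
  | succ N =>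
    refine hodgeConjectureFor_biproduct_of_cmFamilyRank_fiber_add_card_eq κb (fun c => ?_) hadd hA (fun c J _ _ π => ?_) κ
    · cases c
      · exact ⟨0, by decide⟩
      · exact ⟨1, by decide⟩
    · cases c
      · -- the block `{A₀, E'}`: gen 31's G6 (any CM curve × any simple CM threefold)
        have key : ∀ i : Fin 3, κb i = false →
            (![A₀, A₁, E'] : Fin 3 → AbelianVariety ℂ) i = (![E', A₀] : Fin 2 → AbelianVariety ℂ) (if i = 0 then 1 else 0) := by
          intro i hi
          fin_cases i
          · rfl
          · exact absurd hi (by decide)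
          · rfl
        have hfun : (fun j => (![A₀, A₁, E'] : Fin 3 → AbelianVariety ℂ) (π j).1) =
            fun j => (![E', A₀] : Fin 2 → AbelianVariety ℂ) (if (π j).1 = 0 then 1 else 0) := funext fun j => key (π j).1 (π j).2
        rw [hfun]
        exact hodgeConjectureFor_of_isIsogenous_biproduct_comp_of_cmCurve_simpleThreefold_of_markman hW4 h2' h6₀ hE' hA₀ hS₀
          (fun j => if (π j).1 = 0 then 1 else 0) (AbelianVariety.IsIsogenous.refl _)
      · -- the block `{A₁}`: powers of `A₁`
        have hfun : (fun j => (![A₀, A₁, E'] : Fin 3 → AbelianVariety ℂ) (π j).1) = fun _ : J => A₁ :=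
          funext fun j => by rw [of_decide_eq_true (π j).2]; rfl
        rw [hfun]
        let ε : Fin (Fintype.card J) ≃ J := (Fintype.equivFin J).symm
        exact Domination.hodgeConjectureFor_of_avDominatedBy (hodgeConjectureFor_biproduct_const_of_dim_le_three hA₁ h3₁ (Fintype.card J))
          (Domination.AVDominatedBy.of_iso (biproduct.reindex ε fun _ : J => A₁).symm (Domination.AVDominatedBy.refl _))

/-! ## §2 Where a CM elliptic curve can go: not into a quartic field with a primitive type; into a quadratic one only up to isogeny -/

omit [IsCMField k'] in
/-- **A simple CM SURFACE receives no CM elliptic curve**: if `A₀ ⊨ (K₀; Φ₀)` is simple with `[K₀ : ℚ] = 4` then no imaginary quadratic field embeds in `K₀` (b16: a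
quartic CM field with a primitive type carries an automorphism of `ℂ` squaring to conjugation on its embeddings, which excludes totally complex quadratic subfields).
[cite: Shimura1998, §8.4 (2)] [cite: Gordon1999HodgeAVSurvey, §3 Theorem (proof)] -/
theorem isEmpty_ringHom_of_isSimple_of_finrank_eq_four [IsTotallyComplex k'] (h4 : Module.finrank ℚ K₀ = 4) (h2' : Module.finrank ℚ k' = 2)
    (hA₀ : IsCMTypeRealisation Φ₀ A₀ ι₀ θ₀) (hS₀ : A₀.IsSimple) : IsEmpty (k' →+* K₀) := by
  obtain ⟨φ₀⟩ : Nonempty (K₀ →+* ℂ) := inferInstance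
  exact isEmpty_ringHom_of_smul_smul_of_isTotallyComplex h2'
    (QuarticCM.exists_ringAut_smul_smul_eq_conjugate_of_isPrimitive h4 ((isSimple_iff_isPrimitive hA₀ φ₀).1 hS₀))

omit [IsCMField k'] in
/-- **A CM elliptic curve whose field embeds in the QUADRATIC field of `A₀` is isogenous to `A₀`** (`k′ ≅ K₀`; two CM elliptic curves with the same CM field are
isogenous, b16's `isIsogenous_of_ringEquiv`). [cite: Shimura1998, §6.1 Corollary of Theorem 2 (p. 41)] -/
theorem isIsogenous_of_ringHom_of_finrank_eq_two (h2₀ : Module.finrank ℚ K₀ = 2) (h2' : Module.finrank ℚ k' = 2) (hA₀ : IsCMTypeRealisation Φ₀ A₀ ι₀ θ₀)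
    (hE' : IsCMTypeRealisation Ψ' E' ιE' θE') (i₀ : k' →+* K₀) : AbelianVariety.IsIsogenous A₀ E' := by
  obtain ⟨e⟩ := exists_ringEquiv_of_ringHom_of_finrank_eq i₀ (h2'.trans h2₀.symm)
  exact isIsogenous_of_ringEquiv h2₀ hA₀ hE' e

omit [NumberField K₀] [IsCMField K₀] [NumberField K₁] [IsCMField K₁] [NumberField k'] [IsCMField k'] in
/-- `E′ ∼ A₀`: every product of copies of `A₀, A₁, E′` is isogenous to a product of copies of `A₀, A₁`. [folklore] -/
theorem isIsogenous_biproduct_comp_vec_of_isIsogenous_fst (h : AbelianVariety.IsIsogenous A₀ E') (κ : Fin N → Fin 3) :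
    AbelianVariety.IsIsogenous (⨁ fun j => (![A₀, A₁, E'] : Fin 3 → AbelianVariety ℂ) (κ j))
      (⨁ fun j => (![A₀, A₁] : Fin 2 → AbelianVariety ℂ) ((![0, 1, 0] : Fin 3 → Fin 2) (κ j))) := by
  refine AbelianVariety.IsIsogenous.biproduct fun j => ?_
  show AbelianVariety.IsIsogenous ((![A₀, A₁, E'] : Fin 3 → AbelianVariety ℂ) (κ j))
    ((![A₀, A₁] : Fin 2 → AbelianVariety ℂ) ((![0, 1, 0] : Fin 3 → Fin 2) (κ j)))
  generalize κ j = c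
  fin_cases c
  · exact AbelianVariety.IsIsogenous.refl A₀
  · exact AbelianVariety.IsIsogenous.refl A₁
  · exact h.symm'

omit [NumberField K₀] [IsCMField K₀] [NumberField K₁] [IsCMField K₁] [NumberField k'] [IsCMField k'] in
/-- `E′ ∼ A₁`: every product of copies of `A₀, A₁, E′` is isogenous to a product of copies of `A₀, A₁`. [folklore] -/
theorem isIsogenous_biproduct_comp_vec_of_isIsogenous_snd (h : AbelianVariety.IsIsogenous A₁ E') (κ : Fin N → Fin 3) :
    AbelianVariety.IsIsogenous (⨁ fun j => (![A₀, A₁, E'] : Fin 3 → AbelianVariety ℂ) (κ j))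
      (⨁ fun j => (![A₀, A₁] : Fin 2 → AbelianVariety ℂ) ((![0, 1, 1] : Fin 3 → Fin 2) (κ j))) := by
  refine AbelianVariety.IsIsogenous.biproduct fun j => ?_
  show AbelianVariety.IsIsogenous ((![A₀, A₁, E'] : Fin 3 → AbelianVariety ℂ) (κ j))
    ((![A₀, A₁] : Fin 2 → AbelianVariety ℂ) ((![0, 1, 1] : Fin 3 → Fin 2) (κ j)))
  generalize κ j = c
  fin_cases c
  · exact AbelianVariety.IsIsogenous.refl A₀
  · exact AbelianVariety.IsIsogenous.refl A₁
  · exact h.symm'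

/-! ## §3 Any two simple CM abelian varieties of dimension `≤ 3` and any CM elliptic curve -/

/-- **One direction fixed: `k′ ↪ K₀`, `k′ ↪̸ K₁`**, `A₀, A₁` simple of CM type of dimension `≤ 3`, `E′` a CM elliptic curve: the Hodge conjecture for every
`⨁_j ![A₀, A₁, E′] (κ j)` given only Markman's fourfold theorem — `A₀` is a curve (`E′ ∼ A₀`, G7), never a surface, or a threefold (§1).
[cite: MoonenZarhin1999LowDim, Thm. (0.1), Thm. (0.2)] [cite: Markman2025SurveySecant, Thm. 1.2] [cite: Shimura1998, §6.1 Corollary of Theorem 2 (p. 41), §8.4 (2)] -/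
theorem hodgeConjectureFor_biproduct_comp_vec_of_two_simple_dim_le_three_cmCurve_of_ringHom_of_isEmpty (hW4 : Markman2025_weilClasses_algebraic_abelianFourfold)
    (hA₀ : IsCMTypeRealisation Φ₀ A₀ ι₀ θ₀) (hA₁ : IsCMTypeRealisation Φ₁ A₁ ι₁ θ₁) (hS₀ : A₀.IsSimple) (hS₁ : A₁.IsSimple) (h3₀ : A₀.dim ≤ 3) (h3₁ : A₁.dim ≤ 3)
    (h2' : Module.finrank ℚ k' = 2) (hE' : IsCMTypeRealisation Ψ' E' ιE' θE') (i₀ : k' →+* K₀) (h₁ : IsEmpty (k' →+* K₁)) (κ : Fin N → Fin 3) :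
    HodgeConjectureFor (⨁ fun j => (![A₀, A₁, E'] : Fin 3 → AbelianVariety ℂ) (κ j)).dim (⨁ fun j => (![A₀, A₁, E'] : Fin 3 → AbelianVariety ℂ) (κ j)).X := by
  have hd₀ : Module.finrank ℚ K₀ = 2 ∨ Module.finrank ℚ K₀ = 4 ∨ Module.finrank ℚ K₀ = 6 := by
    have h := Literature.AlgebraicGeometry.Pohlmann1968.finrank_eq_two_mul_dim_of_isCMTypeRealisation hA₀
    have hp : 0 < Module.finrank ℚ K₀ := Module.finrank_pos
    interval_cases hd : A₀.dim <;> omega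
  rcases hd₀ with h2₀ | h4₀ | h6₀
  · -- `A₀` is a curve isogenous to `E'`
    exact hodgeConjectureFor_of_isIsogenous_biproduct_comp_of_any_two_simple_dim_le_three_of_markman hW4 hA₀ hA₁ hS₀ hS₁ h3₀ h3₁ _
      (isIsogenous_biproduct_comp_vec_of_isIsogenous_fst (A₁ := A₁) (isIsogenous_of_ringHom_of_finrank_eq_two h2₀ h2' hA₀ hE' i₀) κ)
  · -- `A₀` a simple surface: `k'` cannot embed
    exact ((isEmpty_ringHom_of_isSimple_of_finrank_eq_four h4₀ h2' hA₀ hS₀).false i₀).elim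
  · -- `A₀` a simple threefold: §1
    exact hodgeConjectureFor_biproduct_comp_vec_of_simpleThreefold_absorbedCurve_simple_dim_le_three_of_markman hW4 h6₀ h2' hA₀ hA₁ hE' hS₀ hS₁ h3₁ i₀ h₁ κ

/-- **MAIN THEOREM — ANY TWO SIMPLE CM ABELIAN VARIETIES OF DIMENSION `≤ 3` AND ANY CM ELLIPTIC CURVE, given ONLY Markman's fourfold theorem.**  `A₀ ⊨ (K₀; Φ₀)`,
`A₁ ⊨ (K₁; Φ₁)` SIMPLE, of CM type, of dimension `≤ 3`; `E′ ⊨ (k′; Ψ′)` a CM elliptic curve — nothing else assumed.  Then for every `κ : Fin N → Fin 3` — every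
`A₀^a × A₁^b × E′^c` — the Hodge conjecture holds for `⨁_j ![A₀, A₁, E′] (κ j)`, GIVEN ONLY `Markman2025_weilClasses_algebraic_abelianFourfold`.  Cases on where `k′`
embeds: neither field (gen 33's S6); exactly one (§3, by curve absorption when that variety is a threefold, by isogeny when it is a curve — a simple surface never
receives `k′`); both (both threefolds: gen 31's G4; else one is a curve isogenous to `E′`: G7).  `HC_CM` is NOT asserted. [cite: MoonenZarhin1999LowDim, Thm. (0.1), Thm. (0.2), §3 (3.1), §5 (5.2)]
[cite: Markman2025SurveySecant, Thm. 1.2] [cite: Gordon1999HodgeAVSurvey, §3 Theorem (proof), 7.5–7.7] [cite: Shimura1998, §6.1 Corollary of Theorem 2 (p. 41), §8.4 (2), §18.1] -/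
theorem hodgeConjectureFor_biproduct_comp_vec_of_any_two_simple_dim_le_three_cmCurve_of_markman (hW4 : Markman2025_weilClasses_algebraic_abelianFourfold)
    (hA₀ : IsCMTypeRealisation Φ₀ A₀ ι₀ θ₀) (hA₁ : IsCMTypeRealisation Φ₁ A₁ ι₁ θ₁) (hS₀ : A₀.IsSimple) (hS₁ : A₁.IsSimple) (h3₀ : A₀.dim ≤ 3) (h3₁ : A₁.dim ≤ 3)
    (h2' : Module.finrank ℚ k' = 2) (hE' : IsCMTypeRealisation Ψ' E' ιE' θE') (κ : Fin N → Fin 3) :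
    HodgeConjectureFor (⨁ fun j => (![A₀, A₁, E'] : Fin 3 → AbelianVariety ℂ) (κ j)).dim (⨁ fun j => (![A₀, A₁, E'] : Fin 3 → AbelianVariety ℂ) (κ j)).X := by
  by_cases h₀ : IsEmpty (k' →+* K₀) <;> by_cases h₁ : IsEmpty (k' →+* K₁)
  · -- `k'` foreign to both fields: gen 33's S6
    exact hodgeConjectureFor_biproduct_comp_vec_of_any_two_simple_dim_le_three_foreignCurve_of_markman hW4 hA₀ hA₁ hS₀ hS₁ h3₀ h3₁ h2' hE' h₀ h₁ κ
  · -- `k' ↪ K₁` only: the one-direction theorem with `A₀`, `A₁` swapped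
    obtain ⟨i₁⟩ := not_isEmpty_iff.1 h₁
    have h := hodgeConjectureFor_biproduct_comp_vec_of_two_simple_dim_le_three_cmCurve_of_ringHom_of_isEmpty hW4 hA₁ hA₀ hS₁ hS₀ h3₁ h3₀ h2' hE' i₁ h₀
      (fun j => Equiv.swap (0 : Fin 3) 1 (κ j))
    rw [biproduct_vec_threefolds_swap κ] at h
    exact h
  · -- `k' ↪ K₀` only
    obtain ⟨i₀⟩ := not_isEmpty_iff.1 h₀
    exact hodgeConjectureFor_biproduct_comp_vec_of_two_simple_dim_le_three_cmCurve_of_ringHom_of_isEmpty hW4 hA₀ hA₁ hS₀ hS₁ h3₀ h3₁ h2' hE' i₀ h₁ κ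
  · -- `k'` in both fields: each `A_i` is a curve isogenous to `E'` or a threefold
    obtain ⟨i₀⟩ := not_isEmpty_iff.1 h₀
    obtain ⟨i₁⟩ := not_isEmpty_iff.1 h₁
    have hd₀ : Module.finrank ℚ K₀ = 2 ∨ Module.finrank ℚ K₀ = 4 ∨ Module.finrank ℚ K₀ = 6 := by
      have h := Literature.AlgebraicGeometry.Pohlmann1968.finrank_eq_two_mul_dim_of_isCMTypeRealisation hA₀
      have hp : 0 < Module.finrank ℚ K₀ := Module.finrank_pos
      interval_cases hd : A₀.dim <;> omega
    have hd₁ : Module.finrank ℚ K₁ = 2 ∨ Module.finrank ℚ K₁ = 4 ∨ Module.finrank ℚ K₁ = 6 := by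
      have h := Literature.AlgebraicGeometry.Pohlmann1968.finrank_eq_two_mul_dim_of_isCMTypeRealisation hA₁
      have hp : 0 < Module.finrank ℚ K₁ := Module.finrank_pos
      interval_cases hd : A₁.dim <;> omega
    rcases hd₀ with h2₀ | h4₀ | h6₀
    · exact hodgeConjectureFor_of_isIsogenous_biproduct_comp_of_any_two_simple_dim_le_three_of_markman hW4 hA₀ hA₁ hS₀ hS₁ h3₀ h3₁ _
        (isIsogenous_biproduct_comp_vec_of_isIsogenous_fst (A₁ := A₁) (isIsogenous_of_ringHom_of_finrank_eq_two h2₀ h2' hA₀ hE' i₀) κ)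
    · exact ((isEmpty_ringHom_of_isSimple_of_finrank_eq_four h4₀ h2' hA₀ hS₀).false i₀).elim
    rcases hd₁ with h2₁ | h4₁ | h6₁
    · exact hodgeConjectureFor_of_isIsogenous_biproduct_comp_of_any_two_simple_dim_le_three_of_markman hW4 hA₀ hA₁ hS₀ hS₁ h3₀ h3₁ _
        (isIsogenous_biproduct_comp_vec_of_isIsogenous_snd (A₀ := A₀) (isIsogenous_of_ringHom_of_finrank_eq_two h2₁ h2' hA₁ hE' i₁) κ)
    · exact ((isEmpty_ringHom_of_isSimple_of_finrank_eq_four h4₁ h2' hA₁ hS₁).false i₁).elim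
    · -- two threefolds through `k'`: gen 31's G4
      have h := hodgeConjectureFor_biproduct_comp_vec_of_two_simpleThreefolds_of_markman hW4 h2' h6₀ h6₁ i₀ i₁ hE' hA₀ hA₁ hS₀ hS₁
        (fun j => (![1, 2, 0] : Fin 3 → Fin 3) (κ j))
      rw [biproduct_vec_curve_front κ] at h
      exact h

/-- **`A₀ × A₁ × E′` itself**, for any two simple CM abelian varieties of dimension `≤ 3` and any CM elliptic curve, given only Markman's fourfold theorem.
[cite: MoonenZarhin1999LowDim, Thm. (0.1), (0.2)] [cite: Markman2025SurveySecant, Thm. 1.2] -/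
theorem hodgeConjectureFor_biproduct_vec_of_any_two_simple_dim_le_three_cmCurve_of_markman (hW4 : Markman2025_weilClasses_algebraic_abelianFourfold)
    (hA₀ : IsCMTypeRealisation Φ₀ A₀ ι₀ θ₀) (hA₁ : IsCMTypeRealisation Φ₁ A₁ ι₁ θ₁) (hS₀ : A₀.IsSimple) (hS₁ : A₁.IsSimple) (h3₀ : A₀.dim ≤ 3) (h3₁ : A₁.dim ≤ 3)
    (h2' : Module.finrank ℚ k' = 2) (hE' : IsCMTypeRealisation Ψ' E' ιE' θE') :
    HodgeConjectureFor (⨁ (![A₀, A₁, E'] : Fin 3 → AbelianVariety ℂ)).dim (⨁ (![A₀, A₁, E'] : Fin 3 → AbelianVariety ℂ)).X :=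
  hodgeConjectureFor_biproduct_comp_vec_of_any_two_simple_dim_le_three_cmCurve_of_markman hW4 hA₀ hA₁ hS₀ hS₁ h3₀ h3₁ h2' hE' (id : Fin 3 → Fin 3)

/-- **Dominated form**: everything dominated by some `A₀^a × A₁^b × E′^c` (everything isogenous to such a product, every abelian subvariety or quotient of one), for any two
simple CM abelian varieties of dimension `≤ 3` and any CM elliptic curve, given only Markman's fourfold theorem. [cite: MoonenZarhin1999LowDim, Thm. (0.1), (0.2)]
[cite: Markman2025SurveySecant, Thm. 1.2] [cite: MumfordAV1970, §19 Thm. 1 and p. 169] -/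
theorem hodgeConjectureFor_of_avDominatedBy_comp_vec_of_any_two_simple_dim_le_three_cmCurve_of_markman (hW4 : Markman2025_weilClasses_algebraic_abelianFourfold)
    (hA₀ : IsCMTypeRealisation Φ₀ A₀ ι₀ θ₀) (hA₁ : IsCMTypeRealisation Φ₁ A₁ ι₁ θ₁) (hS₀ : A₀.IsSimple) (hS₁ : A₁.IsSimple) (h3₀ : A₀.dim ≤ 3) (h3₁ : A₁.dim ≤ 3)
    (h2' : Module.finrank ℚ k' = 2) (hE' : IsCMTypeRealisation Ψ' E' ιE' θE') (κ : Fin N → Fin 3) {X : AbelianVariety ℂ}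
    (hX : Domination.AVDominatedBy X (⨁ fun j => (![A₀, A₁, E'] : Fin 3 → AbelianVariety ℂ) (κ j))) : HodgeConjectureFor X.dim X.X :=
  Domination.hodgeConjectureFor_of_avDominatedBy
    (hodgeConjectureFor_biproduct_comp_vec_of_any_two_simple_dim_le_three_cmCurve_of_markman hW4 hA₀ hA₁ hS₀ hS₁ h3₀ h3₁ h2' hE' κ) hX

/-- **Every abelian variety ISOGENOUS TO A PRODUCT OF COPIES of `A₀, A₁, E′`** (any finite index type), for any two simple CM abelian varieties of dimension `≤ 3` and any
CM elliptic curve, given only Markman's fourfold theorem. [cite: MoonenZarhin1999LowDim, Thm. (0.1), (0.2)] [cite: Markman2025SurveySecant, Thm. 1.2] [cite: MumfordAV1970, §19] -/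
theorem hodgeConjectureFor_of_isIsogenous_biproduct_comp_of_any_two_simple_dim_le_three_cmCurve_of_markman
    (hW4 : Markman2025_weilClasses_algebraic_abelianFourfold) (hA₀ : IsCMTypeRealisation Φ₀ A₀ ι₀ θ₀) (hA₁ : IsCMTypeRealisation Φ₁ A₁ ι₁ θ₁)
    (hS₀ : A₀.IsSimple) (hS₁ : A₁.IsSimple) (h3₀ : A₀.dim ≤ 3) (h3₁ : A₁.dim ≤ 3) (h2' : Module.finrank ℚ k' = 2) (hE' : IsCMTypeRealisation Ψ' E' ιE' θE')
    {J : Type} [Fintype J] (cls : J → Fin 3) {X : AbelianVariety ℂ}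
    (hX : AbelianVariety.IsIsogenous X (⨁ fun j => (![A₀, A₁, E'] : Fin 3 → AbelianVariety ℂ) (cls j))) : HodgeConjectureFor X.dim X.X := by
  let ε : Fin (Fintype.card J) ≃ J := (Fintype.equivFin J).symm
  have e : (⨁ fun j => (![A₀, A₁, E'] : Fin 3 → AbelianVariety ℂ) (cls j)) ≅ ⨁ fun l => (![A₀, A₁, E'] : Fin 3 → AbelianVariety ℂ) (cls (ε l)) :=
    (biproduct.reindex ε fun j => (![A₀, A₁, E'] : Fin 3 → AbelianVariety ℂ) (cls j)).symm
  exact hodgeConjectureFor_of_avDominatedBy_comp_vec_of_any_two_simple_dim_le_three_cmCurve_of_markman hW4 hA₀ hA₁ hS₀ hS₁ h3₀ h3₁ h2' hE' (fun l => cls (ε l))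
    (Domination.AVDominatedBy.of_isIsogenous hX (Domination.AVDominatedBy.of_iso e (Domination.AVDominatedBy.refl _)))

end DimLeThreeCurve

end Summit.HodgeConjecture.CorCM.MultiFieldWeil

end
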